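import Summits.HodgeConjecture.HodgeConjecture.Theses.EndoscopicMiddleDegree
import Literature.AlgebraicGeometry.HodgeTheory.HardLefschetzHodgeRiemann
import Literature.AlgebraicGeometry.HodgeTheory.GysinHodgeClassLiftProofs
import Literature.AlgebraicGeometry.HodgeTheory.RationalClassesRingChange
import Literature.AlgebraicGeometry.HodgeTheory.HodgeTypeConjugation
import Literature.AlgebraicGeometry.HodgeTheory.SupportedClassesHodgeConiveau
import Literature.AlgebraicGeometry.HodgeTheory.HodgeModelExistence
import Literature.NumberTheory.Transcendental.DeRhamTheorem

/-!
# Crux `AlgebraicOrEnveloped` (stmt-HodgeConjecture-14943), line `Sketch` — stub `stub_gysinNull`: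
# the hull lemma (an `Alg`-orthogonal rational Hodge class is killed by every admissible hull)

Helper file for the line skeleton of the crux `AlgebraicOrEnveloped` of route
`EndoscopicMiddleDegree` (registered stub `stub_gysinNull`). Notation: `n = m + 1`; `X` smooth
projective of dimension `2n`; `e ∈ H^{2n}(X(ℂ); ℂ)` a rational Hodge `(n,n)`-class which is
CUP-ORTHOGONAL to every algebraic class of `X` of codimension `n` (`e ∪ x = 0` for
`x ∈ algebraicClasses X n`); `X'` ("a hull") smooth projective of dimension `3n` on which the Hodge
conjecture holds for rational `(n,n)`-classes in degree `2n` (hypothesis `HullHC`); `ι : X ⟶ X'` a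
morphism; `μ` an orientation family with Poincaré duality,
`ι_* = complexGysin μ hX hX' ι : H^{2n}(X(ℂ); ℂ) → H^{4n}(X'(ℂ); ℂ)`.

CLAIM (`stub_gysinNull`). Granted the Kähler package `hardLefschetz_hodgeRiemann` (through the
perfect pairing (6.1) on Hodge classes), Hodge models, de Rham's theorem in multiplicative form and
the stability of algebraic classes under pull-back (`hpb`, the neighbouring stub
`stub_pullbackAlgebraic` of the skeleton, taken as a hypothesis): `w := ι_* e = 0`.

PROOF. (1) `w` is rational up to ONE non-zero scalar (`exists_smul_isRationalClass_complexGysin`):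
`e = ι(y)` for the change of coefficients `ι : H(–; ℚ) → H(–; ℂ)`, and
`ι_*(ι y) = u • ι(rational Gysin of y)` with `u ≠ 0` (`complexGysin_ringChange_eq_smul_gysinMap`),
so `w = u • w₀` with `w₀` rational. (2) `w`, hence `w₀ = u⁻¹ • w`, is of Hodge type `(2n, 2n)` on
`X'` (`isOfHodgeType_complexGysin`: Gysin morphisms have bidegree `(r, r)`). (3) For every rational
`(n,n)`-class `a` on `X'`, `w ∪ a = 0` (`cupProduct_complexGysin_eq_zero_of_cup_pullback_eq_zero`):
`w ∪ a = a ∪ w = ι_*(ι^* a ∪ e)` (graded commutativity in even degrees and the projection formula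
`complexGysin_cup`), and `ι^* a ∪ e = e ∪ ι^* a = 0` by the orthogonality hypothesis, because
`a ∈ algebraicClasses X' n` (`HullHC`) and then `ι^* a ∈ algebraicClasses X n` (`hpb`). (4) If
`w₀ ≠ 0`, the perfect pairing (6.1) on `X'` in degrees `(4n, 2n)`
(`hardLefschetz_hodgeRiemann.hodgeClasses_cupPairing_nondegenerate`) yields a rational `(n,n)`-class
`a` with `w₀ ∪ a ≠ 0`, contradicting `u • (w₀ ∪ a) = w ∪ a = 0`; hence `w₀ = 0` and `w = u • 0 = 0`.

The hypothesis `hG` (Grothendieck's coniveau inclusion) of the registered signature is not used.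
-/

noncomputable section

-- `Summit.HodgeConjecture.HodgeConjecture.Theorems` is the mandated namespace (single-problem
-- summit), flagged by `linter.dupNamespace` on every declaration; restated here for stand-alone
-- elaboration.
set_option linter.dupNamespace false

open CategoryTheory MonoidalCategory CartesianMonoidalCategory
open Literature.AlgebraicGeometry.Motives Literature.AlgebraicGeometry.HodgeTheory
open Literature.AlgebraicTopology.SingularHomology
open scoped Manifold

namespace Summit.HodgeConjecture.HodgeConjecture.Theorems

/-- **A Gysin image of a rational class is rational up to ONE non-zero scalar.** For a morphism
`f : Y ⟶ X` of smooth projective varieties of dimensions `d`, `n`, an orientation family `μ` with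
Poincaré duality and a rational class `y ∈ Hᵃ(Y(ℂ); ℂ)` (`a + q = 2d`, `b + q = 2n`), there are
`u ∈ ℂ`, `u ≠ 0`, and a RATIONAL class `w ∈ Hᵇ(X(ℂ); ℂ)` with `f_* y = u • w`: `y = ι x` for the
change of coefficients `ι : H(–; ℚ) → H(–; ℂ)` (`IsRationalClass.exists_ringChange_eq`), and
`f_*(ι x) = u • ι(gysinMap ν_Y ν_X f(ℂ) x)` for `ℚ`-orientations `ν_Y`, `ν_X` with Poincaré duality
(`exists_ratOrientation_hasPoincareDuality`, `complexGysin_ringChange_eq_smul_gysinMap`).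
[cite: FultonYoungTableaux1997, Appendix B §B.1 (5)] [cite: VoisinHodgeI2002, §7.3.2] -/
private theorem exists_smul_isRationalClass_complexGysin {μ : OrientationFamily}
    (hμ : μ.HasPoincareDuality) {d n : ℕ} {Y X : SchemeOver ℂ} (hY : IsSmoothProjective d Y)
    (hX : IsSmoothProjective n X) (f : Y ⟶ X) {a b q : ℕ} (ha : a + q = 2 * d)
    (hb : b + q = 2 * n) (hab : a + 2 * n = b + 2 * d) {y : complexBetti Y a}
    (hy : IsRationalClass y) :
    ∃ (u : ℂ) (w : complexBetti X b), u ≠ 0 ∧ IsRationalClass w ∧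
      complexGysin μ hY hX f hab y = u • w := by
  obtain ⟨x, rfl⟩ := hy.exists_ringChange_eq
  obtain ⟨νY, -⟩ := exists_ratOrientation_hasPoincareDuality hY
  obtain ⟨νX, hνX⟩ := exists_ratOrientation_hasPoincareDuality hX
  obtain ⟨u, hu, hcomp⟩ := complexGysin_ringChange_eq_smul_gysinMap hμ hY hX f ha hb νY νX hνX
  exact ⟨u, _, hu, isRationalClass_ringChange _, hcomp x⟩

/-- **Adjunction through the projection formula.** For a morphism `ι : X ⟶ X'` of smooth projective
varieties, `a ∈ Hᵖ(X'(ℂ); ℂ)` and `e ∈ Hᵠ(X(ℂ); ℂ)` with `e ∪ ι^* a = 0`: `ι_* e ∪ a = 0`. Indeed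
`ι_* e ∪ a = ± a ∪ ι_* e` (graded commutativity), `a ∪ ι_* e = ι_*(ι^* a ∪ e)` (projection formula
`complexGysin_cup`), and `ι^* a ∪ e = ± e ∪ ι^* a = 0`.
[cite: FultonYoungTableaux1997, Appendix B §B.1 (6)] [cite: HatcherAT2002, §3.2 Thm. 3.11] -/
private theorem cupProduct_complexGysin_eq_zero_of_cup_pullback_eq_zero {μ : OrientationFamily}
    (hμ : μ.HasPoincareDuality) {dX dX' : ℕ} {X X' : SchemeOver ℂ} (hX : IsSmoothProjective dX X)
    (hX' : IsSmoothProjective dX' X') (ι : X ⟶ X') {p q s b t : ℕ} (hpq : p + q = s)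
    (hqp : q + p = s) (hdeg : q + 2 * dX' = b + 2 * dX) (hbp : b + p = t) (hpb : p + b = t)
    (a : complexBetti X' p) (e : complexBetti X q)
    (h : cupProduct hqp e (complexBetti.map ι p a) = 0) :
    cupProduct hbp (complexGysin μ hX hX' ι hdeg e) a = 0 := by
  -- `ι^* a ∪ e = ± e ∪ ι^* a = 0`
  have h1 : cupProduct hpq (complexBetti.map ι p a) e = 0 := by
    rw [cupProduct_gradedComm_holds ℂ (ComplexPoints X) hpq hqp _ e, h, smul_zero]
  -- projection formula: `ι_*(ι^* a ∪ e) = a ∪ ι_* e`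
  have h2 := complexGysin_cup hμ hX hX' ι hpq (show s + 2 * dX' = t + 2 * dX by omega) hdeg hpb a e
  rw [h1, map_zero] at h2
  -- `ι_* e ∪ a = ± a ∪ ι_* e = ± ι_*(0) = 0`
  rw [cupProduct_gradedComm_holds ℂ (ComplexPoints X') hbp hpb _ a, ← h2, smul_zero]

/-- **Registered stub `stub_gysinNull`** (crux stmt-HodgeConjecture-14943, line `Sketch`; the hull
lemma). For an orientation family `μ` with Poincaré duality, a rational Hodge `(m+1,m+1)`-class `e`
on the smooth projective `2(m+1)`-fold `X` with `e ∪ x = 0` for all `x ∈ algebraicClasses X (m+1)`,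
a smooth projective `3(m+1)`-fold `X'` on which rational `(m+1,m+1)`-classes in degree `2(m+1)`
are algebraic, and a morphism `ι : X ⟶ X'`: `ι_* e = 0` in `H^{4(m+1)}(X'(ℂ); ℂ)`. Granted: the
Kähler package `hardLefschetz_hodgeRiemann` for all `(d, Y)` (`hK`, used on `X'` through the perfect
pairing (6.1) `hodgeClasses_cupPairing_nondegenerate`), Hodge models (`hM`) and de Rham's theorem in
multiplicative form (`hdR`) (Gysin morphisms have bidegree `(r, r)`, `isOfHodgeType_complexGysin`),
and pull-back stability of algebraic classes (`hpb`); `hG` is carried by the registered signature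
and not used. Proof: `w = ι_* e = u • w₀`, `u ≠ 0`, `w₀` rational
(`exists_smul_isRationalClass_complexGysin`) of type `(2(m+1), 2(m+1))`; `w ∪ a = 0` for every
rational `(m+1,m+1)`-class `a` on `X'` (`cupProduct_complexGysin_eq_zero_of_cup_pullback_eq_zero`,
since `ι^* a` is algebraic by `HullHC` and `hpb`); so `w₀ ∪ a = 0` for all such `a`, whence `w₀ = 0`
by (6.1) on `X'`, and `w = 0`. [cite: BrosnanFangNiePearlstein2009, §6 (6.1)]
[cite: VoisinHodgeI2002, §7.3.2 (with Lemma 7.30)]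
[cite: FultonYoungTableaux1997, Appendix B §B.1 (5)–(6)] -/
theorem stub_gysinNull
    (hK : ∀ (d : ℕ) (Y : SchemeOver ℂ), hardLefschetz_hodgeRiemann d Y)
    (hG : Grothendieck1969_supportedClasses_le_hodgeConiveau)
    (hdR : ∀ (E : Type) [NormedAddCommGroup E] [NormedSpace ℂ E] [FiniteDimensional ℂ E],
      Literature.NumberTheory.Transcendental.exists_deRhamIsoFamily 𝓘(ℝ, E))
    (hM : ∀ (d : ℕ) (Y : SchemeOver ℂ), nonempty_hodgeModel d Y)
    (hpb : ∀ ⦃d d' : ℕ⦄ ⦃X X' : SchemeOver ℂ⦄, IsSmoothProjective d X → IsSmoothProjective d' X' →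
      ∀ (ι : X ⟶ X') (k : ℕ) (y : complexBetti X' (2 * k)), y ∈ algebraicClasses X' k →
        complexBetti.map ι (2 * k) y ∈ algebraicClasses X k) :
    ∀ (μ : OrientationFamily), μ.HasPoincareDuality →
    ∀ (m : ℕ) (X : SchemeOver ℂ) (hX : IsSmoothProjective (2 * (m + 1)) X)
      (e : complexBetti X (2 * (m + 1))), IsRationalClass e →
      IsOfHodgeType (2 * (m + 1)) X (2 * (m + 1)) (m + 1) (m + 1) e →
      (∀ x ∈ algebraicClasses X (m + 1), cupProduct (two_mul_add_two_mul (m + 1) (m + 1)) e x = 0) →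
      ∀ (X' : SchemeOver ℂ) (hX' : IsSmoothProjective (3 * (m + 1)) X') (ι : X ⟶ X'),
        (∀ a : complexBetti X' (2 * (m + 1)), IsRationalClass a →
          IsOfHodgeType (3 * (m + 1)) X' (2 * (m + 1)) (m + 1) (m + 1) a →
          a ∈ algebraicClasses X' (m + 1)) →
        complexGysin μ hX hX' ι
          (show 2 * (m + 1) + 2 * (3 * (m + 1)) = 2 * (2 * (m + 1)) + 2 * (2 * (m + 1)) by ring) e = 0 := by
  -- Grothendieck's coniveau inclusion `hG` is part of the registered signature and is merely
  -- acknowledged here (the Hodge types needed are those of `e` and of the test classes `a`)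
  have _ := hG
  intro μ hμ m X hX e he heT horth X' hX' ι hHC
  have hdeg : 2 * (m + 1) + 2 * (3 * (m + 1)) = 2 * (2 * (m + 1)) + 2 * (2 * (m + 1)) := by ring
  show complexGysin μ hX hX' ι hdeg e = 0
  have htop : 2 * (2 * (m + 1)) + 2 * (m + 1) = 2 * (3 * (m + 1)) := by ring
  -- (3) `ι_* e ∪ a = 0` for every rational `(m+1,m+1)`-class `a` on `X'`
  have hcup : ∀ a : complexBetti X' (2 * (m + 1)), IsRationalClass a →
      IsOfHodgeType (3 * (m + 1)) X' (2 * (m + 1)) (m + 1) (m + 1) a →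
      cupProduct htop (complexGysin μ hX hX' ι hdeg e) a = 0 := fun a haQ haT ↦
    cupProduct_complexGysin_eq_zero_of_cup_pullback_eq_zero hμ hX hX' ι
      (two_mul_add_two_mul (m + 1) (m + 1)) (two_mul_add_two_mul (m + 1) (m + 1)) hdeg htop
      (by ring) a e (horth _ (hpb hX hX' ι (m + 1) a (hHC a haQ haT)))
  -- (2) `ι_* e` is of Hodge type `(2(m+1), 2(m+1))` on `X'`
  have hwT : IsOfHodgeType (3 * (m + 1)) X' (2 * (2 * (m + 1))) (2 * (m + 1)) (2 * (m + 1))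
      (complexGysin μ hX hX' ι hdeg e) :=
    isOfHodgeType_complexGysin hodgePQ_independent_of_hodgeModel_holds hM hdR μ hX hX' ι hdeg
      (show 2 * (m + 1) + 2 * (m + 1) = m + 1 + 3 * (m + 1) by ring)
      (show 2 * (m + 1) + 2 * (m + 1) = m + 1 + 3 * (m + 1) by ring) heT
  -- (1) `ι_* e = u • w₀`, `u ≠ 0`, `w₀` rational (and of the same Hodge type)
  obtain ⟨u, w₀, hu, hw₀Q, hw⟩ := exists_smul_isRationalClass_complexGysin hμ hX hX' ι
    (show 2 * (m + 1) + 2 * (m + 1) = 2 * (2 * (m + 1)) by ring) htop hdeg he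
  have hw₀T :
      IsOfHodgeType (3 * (m + 1)) X' (2 * (2 * (m + 1))) (2 * (m + 1)) (2 * (m + 1)) w₀ := by
    have h : u⁻¹ • complexGysin μ hX hX' ι hdeg e = w₀ := by
      rw [hw, smul_smul, inv_mul_cancel₀ hu, one_smul]
    exact h ▸ hwT.smul u⁻¹
  -- (4) the perfect pairing (6.1) on `X'` in degrees `(4(m+1), 2(m+1))`: `w₀ = 0`
  have hw₀ : w₀ = 0 := by
    by_contra hne
    obtain ⟨a, haQ, haT, hne'⟩ :=
      (hK (3 * (m + 1)) X').hodgeClasses_cupPairing_nondegenerate hX' (2 * (3 * (m + 1)))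
        (show 2 * (m + 1) + (m + 1) = 3 * (m + 1) by ring) htop w₀ hw₀Q hw₀T hne
    have h0 := hcup a haQ haT
    rw [hw, map_smul, LinearMap.smul_apply] at h0
    exact hne' ((smul_eq_zero.1 h0).resolve_left hu)
  rw [hw, hw₀, smul_zero]

end Summit.HodgeConjecture.HodgeConjecture.Theorems

end
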